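import Mathlib.RingTheory.PowerSeries.Derivative
import Mathlib.RingTheory.PowerSeries.Order
import Mathlib.RingTheory.Polynomial.Pochhammer
import Mathlib.Data.Nat.Choose.Sum
import Mathlib.Tactic
import HarnessLib

/-!
# The differential equation `(1 + X)·Q′ = e·Q` of the binomial series `(1 + X)^e`
# (Gouvêa, *p-adic Numbers*, §5.9: the binomial series `B(α, X)`)

Topic `NumberTheory/LocalFields`; namespace `Literature.NumberTheory.LocalFields`. Everything here is
proved (theorems only; no definitions, no named facts); pure algebra over a field `K` of
characteristic `0` (resp. a commutative ring for the Leibniz rule).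

The binomial series `B_e(X) = (1+X)^e = Σₙ C(e,n) Xⁿ` (Gouvêa §5.9, "`B(α, X) = Σ C(α,n) Xⁿ`") is
characterised among series with constant term `1` by `(1 + X)·B′ = e·B`; we never name it and work
with any `Q` satisfying `(1 + X)·Q′ = e·Q`:

* §1 `coeff_succ_of_ode` (`(n+1)[X^{n+1}]Q = (e−n)[Xⁿ]Q`), `coeff_mul_factorial_of_ode`
  (`n!·[Xⁿ]Q = Q(0)·e(e−1)⋯(e−n+1)`), `constantCoeff_smul_eq_of_ode` (uniqueness up to a constant),
  `ode_binomialSeries_mk` (existence: `Σ e(e−1)⋯(e−n+1)/n!·Xⁿ` is a solution);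
* §2 **`exists_ode_of_wronskian`** — if `F ≠ 0` and `(1+X)(F·F'′ − F'·F′) = e·F·F'` (the symmetric,
  division-free form of "`F'/F` satisfies the equation") then `F' = Q·F` with `(1+X)Q′ = eQ`
  (through "vanishing Wronskian ⟹ proportional", `bst_eq_C_mul_of_wronskian`, proved by comparing
  lowest terms with the Euler operator `X·d/dX`);
* §3 `iterate_derivative_mul_eq_sum_antidiagonal` — the iterated Leibniz rule for
  `PowerSeries.derivative`, and **`one_add_X_pow_mul_iterate_derivative_of_ode`** —
  `(1+X)^i·Q^{(i)} = e(e−1)⋯(e−i+1)·Q`.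

Used by `BinomialTwistExponentPadicIntegral.lean` (if `F' = c(1+X)^e F` with `F, F'` `p`-integral
of unit content then `e ∈ ℤ_p`).

## References

* F. Q. Gouvêa, *p-adic Numbers: An Introduction*, Universitext, Springer 1993, §5.9 (the binomial
  series), Lemma 5.9.1 and Problem 194 (held text pp. 131–132). [Gouvea1993PadicNumbers]
-/

noncomputable section

open Finset PowerSeries

namespace Literature.NumberTheory.LocalFields

/-! ## §1. The differential equation `(1 + X)·Q' = e·Q` -/

section ODE

variable {K : Type*} [Field K] [CharZero K]

/-- Coefficients of `(1 + X)·G'`: `[Xⁿ]((1+X)G') = (n+1)[X^{n+1}]G + n[Xⁿ]G`. [folklore] -/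
private theorem bst_coeff_one_add_X_mul_derivative (G : K⟦X⟧) (n : ℕ) :
    coeff n ((1 + X) * derivative K G) = (n + 1) * coeff (n + 1) G + n * coeff n G := by
  rw [add_mul, one_mul, map_add, coeff_derivative]
  cases n with
  | zero => simp
  | succ n =>
    rw [coeff_succ_X_mul, coeff_derivative]
    push_cast
    ring

/-- **The recursion.** If `(1 + X)·Q' = e·Q` then `(n+1)·[X^{n+1}]Q = (e − n)·[Xⁿ]Q`.
[cite: Gouvea1993PadicNumbers, §5.9 (the binomial series `B(α, X)`, p. 131)] -/
theorem coeff_succ_of_ode {Q : K⟦X⟧} {e : K} (hQ : (1 + X) * derivative K Q = C e * Q) (n : ℕ) :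
    (n + 1) * coeff (n + 1) Q = (e - n) * coeff n Q := by
  have h := congrArg (coeff n) hQ
  rw [bst_coeff_one_add_X_mul_derivative, coeff_C_mul] at h
  linear_combination h

/-- **Closed form.** If `(1 + X)·Q' = e·Q` then `n!·[Xⁿ]Q = Q(0)·e(e−1)⋯(e−n+1)`.
[cite: Gouvea1993PadicNumbers, §5.9 (the binomial series `B(α, X)`, p. 131)] -/
theorem coeff_mul_factorial_of_ode {Q : K⟦X⟧} {e : K} (hQ : (1 + X) * derivative K Q = C e * Q)
    (n : ℕ) : (n.factorial : K) * coeff n Q = constantCoeff Q * ∏ j ∈ range n, (e - (j : K)) := by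
  induction n with
  | zero => simp
  | succ n ih =>
    calc ((n + 1).factorial : K) * coeff (n + 1) Q
        = (n.factorial : K) * ((n + 1) * coeff (n + 1) Q) := by
          rw [Nat.factorial_succ]; push_cast; ring
      _ = (n.factorial : K) * ((e - n) * coeff n Q) := by rw [coeff_succ_of_ode hQ n]
      _ = (e - n) * ((n.factorial : K) * coeff n Q) := by ring
      _ = (e - n) * (constantCoeff Q * ∏ j ∈ range n, (e - (j : K))) := by rw [ih]
      _ = constantCoeff Q * ∏ j ∈ range (n + 1), (e - (j : K)) := by rw [prod_range_succ]; ring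

/-- **Uniqueness.** Two solutions of `(1 + X)·Q' = e·Q` are proportional: `Q(0)·R = R(0)·Q`.
[cite: Gouvea1993PadicNumbers, §5.9 (the binomial series `B(α, X)`, p. 131)] -/
theorem constantCoeff_smul_eq_of_ode {Q R : K⟦X⟧} {e : K}
    (hQ : (1 + X) * derivative K Q = C e * Q) (hR : (1 + X) * derivative K R = C e * R) :
    constantCoeff Q • R = constantCoeff R • Q := by
  ext n
  rw [coeff_smul, coeff_smul, smul_eq_mul, smul_eq_mul]
  have hn : (n.factorial : K) ≠ 0 := by exact_mod_cast Nat.factorial_ne_zero n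
  apply mul_left_cancel₀ hn
  have hR' := coeff_mul_factorial_of_ode hR n
  have hQ' := coeff_mul_factorial_of_ode hQ n
  linear_combination constantCoeff Q * hR' - constantCoeff R * hQ'

/-- **Existence.** The normalised binomial series `B_e = Σₙ e(e−1)⋯(e−n+1)/n! · Xⁿ` solves
`(1 + X)·B' = e·B` (and `B_e(0) = 1`). [cite: Gouvea1993PadicNumbers, §5.9 (the binomial series `B(α, X)`, p. 131)] -/
theorem ode_binomialSeries_mk (e : K) :
    (1 + X) * derivative K (PowerSeries.mk fun n : ℕ ↦ (∏ j ∈ range n, (e - (j : K))) / (n.factorial : K)) =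
      C e * PowerSeries.mk fun n : ℕ ↦ (∏ j ∈ range n, (e - (j : K))) / (n.factorial : K) := by
  ext n
  rw [bst_coeff_one_add_X_mul_derivative, coeff_C_mul, coeff_mk, coeff_mk, prod_range_succ,
    Nat.factorial_succ]
  have hn : (n.factorial : K) ≠ 0 := by exact_mod_cast Nat.factorial_ne_zero n
  have hn1 : ((n : K) + 1) ≠ 0 := by exact_mod_cast Nat.succ_ne_zero n
  push_cast
  field_simp
  ring

/-! ## §2. From the symmetric ("Wronskian") form to `F' = Q·F` -/

/-- The Euler operator on a monomial multiple: `X·(XⁿΦ)' = Xⁿ·(n·Φ + X·Φ')`. [folklore] -/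
private theorem bst_X_mul_derivative_X_pow_mul (n : ℕ) (Φ : K⟦X⟧) :
    X * derivative K (X ^ n * Φ) = X ^ n * (C (n : K) * Φ + X * derivative K Φ) := by
  induction n generalizing Φ with
  | zero => simp
  | succ n ih =>
    have hX : derivative K (X : K⟦X⟧) = 1 := derivative_X
    have hXΦ : derivative K (X * Φ) = X * derivative K Φ + Φ := by
      rw [(derivative K).leibniz, smul_eq_mul, smul_eq_mul, hX, mul_one]
    rw [pow_succ, mul_assoc, ih (X * Φ), hXΦ]
    push_cast
    rw [map_add, map_one]
    ring

/-- **Vanishing Wronskian ⟹ proportional** (power series over a field of characteristic `0`): if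
`G ≠ 0` and `G·H' = H·G'` then `H = c·G` for a constant `c`. [folklore] -/
private theorem bst_eq_C_mul_of_wronskian {G H : K⟦X⟧} (hG : G ≠ 0)
    (h : G * derivative K H = H * derivative K G) : ∃ c : K, H = C c * G := by
  set N := G.order.toNat with hN
  have hg : coeff N G ≠ 0 := coeff_order hG
  set c : K := coeff N H / coeff N G with hc
  refine ⟨c, ?_⟩
  set Φ : K⟦X⟧ := H - C c * G with hΦ
  suffices hΦ0 : Φ = 0 by rw [hΦ] at hΦ0; exact sub_eq_zero.1 hΦ0
  have hW : G * derivative K Φ = Φ * derivative K G := by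
    have hD : derivative K (C c * G) = C c * derivative K G := by
      rw [← smul_eq_C_mul, ← smul_eq_C_mul, (derivative K).map_smul]
    rw [hΦ, map_sub, hD, mul_sub, sub_mul, h]
    ring
  have hΦN : coeff N Φ = 0 := by
    rw [hΦ, map_sub, coeff_C_mul, hc, div_mul_cancel₀ _ hg, sub_self]
  by_contra hΦ0
  set M := Φ.order.toNat with hM
  have hφ : coeff M Φ ≠ 0 := coeff_order hΦ0
  -- strip the orders: `G = X^N G₀`, `Φ = X^M Φ₀`
  set G₀ := divXPowOrder G with hG₀
  set Φ₀ := divXPowOrder Φ with hΦ₀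
  have hGdec : G = X ^ N * G₀ := X_pow_order_mul_divXPowOrder.symm
  have hΦdec : Φ = X ^ M * Φ₀ := X_pow_order_mul_divXPowOrder.symm
  have h2 : (X ^ N * G₀) * (X * derivative K (X ^ M * Φ₀)) =
      (X ^ M * Φ₀) * (X * derivative K (X ^ N * G₀)) := by
    have h3 : (X ^ N * G₀) * derivative K (X ^ M * Φ₀) = (X ^ M * Φ₀) * derivative K (X ^ N * G₀) := by
      rw [← hGdec, ← hΦdec]; exact hW
    calc _ = X * ((X ^ N * G₀) * derivative K (X ^ M * Φ₀)) := by ring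
      _ = X * ((X ^ M * Φ₀) * derivative K (X ^ N * G₀)) := by rw [h3]
      _ = _ := by ring
  rw [bst_X_mul_derivative_X_pow_mul, bst_X_mul_derivative_X_pow_mul] at h2
  have hW' : X ^ (N + M) * (G₀ * (C (M : K) * Φ₀ + X * derivative K Φ₀)) =
      X ^ (N + M) * (Φ₀ * (C (N : K) * G₀ + X * derivative K G₀)) := by
    calc _ = X ^ N * G₀ * (X ^ M * (C (M : K) * Φ₀ + X * derivative K Φ₀)) := by ring
      _ = X ^ M * Φ₀ * (X ^ N * (C (N : K) * G₀ + X * derivative K G₀)) := by rw [h2]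
      _ = _ := by ring
  have hX : (X : K⟦X⟧) ^ (N + M) ≠ 0 := pow_ne_zero _ X_ne_zero
  have hW'' := mul_left_cancel₀ hX hW'
  have h0 := congrArg constantCoeff hW''
  simp only [map_mul, map_add, constantCoeff_C, constantCoeff_X, zero_mul, add_zero, hG₀, hΦ₀,
    constantCoeff_divXPowOrder] at h0
  rw [← hN, ← hM] at h0
  -- `g·M·φ = φ·N·g` with `g, φ ≠ 0`
  have hMN : (M : K) = N := by
    have h1 : coeff N G * coeff M Φ * (M : K) = coeff N G * coeff M Φ * (N : K) := by
      linear_combination h0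
    exact mul_left_cancel₀ (mul_ne_zero hg hφ) h1
  have hMN' : M = N := by exact_mod_cast hMN
  exact hφ (hMN' ▸ hΦN)

/-- **From the symmetric form to `F' = Q·F`.** If `F ≠ 0` and
`(1 + X)·(F·F'′ − F'·F′) = e·F·F'` (the division-free form of "`(1+X)·(F'/F)′ = e·(F'/F)`"), then
`F' = Q·F` for a solution `Q` of `(1 + X)·Q′ = e·Q` — i.e. `F'` is a binomial twist `c·(1+X)^e·F`.
[cite: Gouvea1993PadicNumbers, §5.9 (the binomial series `B(α, X)`, p. 131)] -/
theorem exists_ode_of_wronskian {F F' : K⟦X⟧} {e : K} (hF : F ≠ 0)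
    (h : (1 + X) * (F * derivative K F' - F' * derivative K F) = C e * (F * F')) :
    ∃ Q : K⟦X⟧, F' = Q * F ∧ (1 + X) * derivative K Q = C e * Q := by
  set B : K⟦X⟧ := PowerSeries.mk fun n : ℕ ↦ (∏ j ∈ range n, (e - (j : K))) / (n.factorial : K)
    with hBdef
  have hB : (1 + X) * derivative K B = C e * B := ode_binomialSeries_mk e
  have hB0 : constantCoeff B = 1 := by
    rw [← coeff_zero_eq_constantCoeff_apply, hBdef, coeff_mk]; simp
  have hBne : B ≠ 0 := fun h0 ↦ by simp [h0] at hB0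
  have hBF : B * F ≠ 0 := mul_ne_zero hBne hF
  -- the Wronskian of `B·F` and `F'` vanishes
  have hW : B * F * derivative K F' = F' * derivative K (B * F) := by
    have h1X : (1 + X : K⟦X⟧) ≠ 0 := by
      intro h0; have := congrArg constantCoeff h0; simp at this
    have key : (1 + X) * (B * (F * derivative K F' - F' * derivative K F) - derivative K B * (F * F')) = 0 := by
      have h2 : B * ((1 + X) * (F * derivative K F' - F' * derivative K F)) = B * (C e * (F * F')) := by
        rw [h]
      calc (1 + X) * (B * (F * derivative K F' - F' * derivative K F) - derivative K B * (F * F'))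
          = B * ((1 + X) * (F * derivative K F' - F' * derivative K F)) - (1 + X) * derivative K B * (F * F') := by
            ring
        _ = B * (C e * (F * F')) - C e * B * (F * F') := by rw [h2, hB]
        _ = 0 := by ring
    rcases mul_eq_zero.1 key with h0 | h0
    · exact absurd h0 h1X
    · rw [(derivative K).leibniz, smul_eq_mul, smul_eq_mul]
      linear_combination h0
  obtain ⟨c, hc⟩ := bst_eq_C_mul_of_wronskian hBF hW
  refine ⟨C c * B, by rw [hc]; ring, ?_⟩
  have hD : derivative K (C c * B) = C c * derivative K B := by
    rw [← smul_eq_C_mul, ← smul_eq_C_mul, (derivative K).map_smul]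
  rw [hD, mul_left_comm, hB]
  ring

end ODE

/-! ## §3. Iterated derivatives: Leibniz, and `(1+X)^i·Q^{(i)} = e(e−1)⋯(e−i+1)·Q` -/

section Iterate

variable {R : Type*} [CommRing R]

/-- **Iterated Leibniz rule** for the formal derivative of power series:
`(fg)^{(n)} = Σ_{i+j=n} C(n,i) f^{(i)} g^{(j)}` (the successive formal derivatives of a product;
companion of `coeff_iterate_derivative`). [cite: Cassels1986, Ch. 6 Exercise 2] -/
theorem iterate_derivative_mul_eq_sum_antidiagonal (f g : R⟦X⟧) (n : ℕ) :
    (derivative R)^[n] (f * g) =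
      ∑ ij ∈ antidiagonal n, ((n.choose ij.1 : ℕ) : R⟦X⟧) *
        ((derivative R)^[ij.1] f * (derivative R)^[ij.2] g) := by
  induction n with
  | zero => simp
  | succ n ih =>
    rw [Function.iterate_succ_apply', ih, map_sum,
      Finset.sum_antidiagonal_choose_succ_mul
        (fun i j ↦ (derivative R)^[i] f * (derivative R)^[j] g) n]
    have hsymm : ∑ ij ∈ antidiagonal n, ((n.choose ij.2 : ℕ) : R⟦X⟧) *
        ((derivative R)^[ij.1 + 1] f * (derivative R)^[ij.2] g) =
        ∑ ij ∈ antidiagonal n, ((n.choose ij.1 : ℕ) : R⟦X⟧) *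
        ((derivative R)^[ij.1 + 1] f * (derivative R)^[ij.2] g) := by
      refine sum_congr rfl fun ij hij ↦ ?_
      rw [Nat.choose_symm_of_eq_add (mem_antidiagonal.1 hij).symm]
    rw [hsymm, ← sum_add_distrib]
    refine sum_congr rfl fun ij _ ↦ ?_
    rw [(derivative R).leibniz, (derivative R).leibniz, smul_eq_mul, smul_eq_mul, smul_eq_mul,
      smul_eq_mul, (derivative R).map_natCast, mul_zero, add_zero, Function.iterate_succ_apply',
      Function.iterate_succ_apply']
    ring

end Iterate

section IterateODE

variable {K : Type*} [Field K]

/-- `i·(1+X)·(1+X)^{i−1} = i·(1+X)^i` (also for `i = 0`). [folklore] -/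
private theorem bst_nsmul_pow_pred (i : ℕ) :
    (i : K⟦X⟧) * ((1 + X) * (1 + X) ^ (i - 1)) = (i : K⟦X⟧) * (1 + X) ^ i := by
  cases i with
  | zero => simp
  | succ i => rw [Nat.add_sub_cancel, pow_succ']

/-- **Higher derivatives of a solution of `(1+X)Q′ = eQ`**: `(1+X)^i·Q^{(i)} = e(e−1)⋯(e−i+1)·Q`
(the identity `(1+X)^i·dⁱ/dXⁱ (1+X)^e = e(e−1)⋯(e−i+1)·(1+X)^e`).
[cite: Gouvea1993PadicNumbers, §5.9 (the binomial series `B(α, X)`, p. 131)] -/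
theorem one_add_X_pow_mul_iterate_derivative_of_ode {Q : K⟦X⟧} {e : K}
    (hQ : (1 + X) * derivative K Q = C e * Q) (i : ℕ) :
    (1 + X) ^ i * (derivative K)^[i] Q = C (∏ j ∈ range i, (e - (j : K))) * Q := by
  induction i with
  | zero => simp
  | succ i ih =>
    -- differentiate the induction hypothesis and multiply by `1 + X`
    have hD1X : derivative K ((1 + X : K⟦X⟧) ^ i) = (i : K⟦X⟧) * (1 + X) ^ (i - 1) := by
      rw [(derivative K).leibniz_pow, map_add, (derivative K).map_one_eq_zero, derivative_X, zero_add,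
        smul_eq_mul, mul_one, nsmul_eq_mul]
    have hDC : derivative K (C (∏ j ∈ range i, (e - (j : K))) * Q) =
        C (∏ j ∈ range i, (e - (j : K))) * derivative K Q := by
      rw [← smul_eq_C_mul, ← smul_eq_C_mul, (derivative K).map_smul]
    have hD := congrArg (derivative K) ih
    rw [(derivative K).leibniz, smul_eq_mul, smul_eq_mul, hD1X, hDC,
      ← Function.iterate_succ_apply' (derivative K)] at hD
    -- `hD : (1+X)^i * Q^{(i+1)} + Q^{(i)} * (i * (1+X)^(i-1)) = C P_i * Q'`
    have h1 : (1 + X) ^ (i + 1) * (derivative K)^[i + 1] Q =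
        (1 + X) * (C (∏ j ∈ range i, (e - (j : K))) * derivative K Q) -
          (i : K⟦X⟧) * ((1 + X) ^ i * (derivative K)^[i] Q) := by
      have h2 := bst_nsmul_pow_pred (K := K) i
      rw [← hD, pow_succ']
      linear_combination (-((derivative K)^[i] Q)) * h2
    rw [h1, ih, mul_left_comm, hQ, prod_range_succ, map_mul, map_sub, map_natCast C i]
    ring

end IterateODE

end Literature.NumberTheory.LocalFields
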